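import Literature.NumberTheory.Sieve.JurkatRichertLinearSieveLower
import HarnessLib

/-!
# Iwaniec's bilinear linear sieve, I: explicit main terms of Rosser's linear sieve for all `s`

Topic `Literature/NumberTheory/Sieve`; first support file for the proof of
`Literature.NumberTheory.Sieve.Iwaniec1978.lemma2_bilinearSieve` (H. Iwaniec, *A new form of the error
term in the linear sieve*, Acta Arith. 37 (1980), 307–320, Theorem 1 [IwaniecActaArith1980b]), whose
"Lemma 3" (ibid. p. 313, (12)–(13) = Lemmas 18 and 20 of *Rosser's sieve*) is the main-term estimate
`M⁺(D, z) ≤ V(z){F(s) + error}` (`z ≤ D`), `M⁻(D, z) ≥ V(z){f(s) − error}` (`z ≤ D^{1/2}`) for Rosser's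
weights with `β = 2`, with an error whose dependence on the constant of the Mertens-type hypothesis is
EXPLICIT.  The tree proves Iwaniec's Theorem 1 of *Rosser's sieve* only with an inexplicit constant
`C(κ, L)` (`Iwaniec1980_mainTerm_upper_of_half_lt`), but it also proves Nathanson's explicit Theorem 9.5
(`JurkatRichert.bdrySum_le`: `T_n(D, z) ≤ V(z)(f_n(s) + (K − 1) c_n m_n(s))` for ALL `s ≥ 1` (`n` odd)
resp. `s ≥ 2` (`n` even), under `JurkatRichert.KCond g K z`, `1 ≤ K ≤ 1 + 1/200`) and Iwaniec's Lemma 18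
(`BetaSieve.Iwaniec1980_lemma18_holds`: `1 + Σ_{n odd ≤ N} f_n(s) ≤ F(s)` for all `s > 0`,
`1 − Σ_{n even ≤ N} f_n(s) ≥ f(s)` for `s ≥ 2`).  Combining them exactly as in the tree's
`JurkatRichert.mainSum_one_le` (which is the case `1 ≤ s ≤ 3`, `F(s) = 2e^γ/s`) gives, for the linear
sieve functions `F = upperSieveFun 1`, `f = lowerSieveFun 1` of `SieveFunctions.lean`:

* `JurkatRichert.mainSum_one_le_upperSieveFun`: `G(z, λ⁺_D) ≤ V(z) (F(s) + (K − 1) e^{14−s})`, `z ≤ D`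
  (all `s ≥ 1`); the lower twin `G(z, λ⁻_D) ≥ V(z) (f(s) − (K − 1) e^{14−s})` (`z² ≤ D`) is the tree's
  `JurkatRichert.mainSum_zero_ge` (`JurkatRichertLinearSieveLower.lean`).

This is Nathanson's Theorem 9.7 [Nathanson1996, Thm 9.7 (9.35)] for the main term, on the full range of
`s` (the printed theorem; the tree's `mainSum_one_le` inserted Theorem 9.8 on `1 ≤ s ≤ 3`).

* `primesProdIco w z = P(z)/P(w) = ∏_{w ≤ p < z} p` — Iwaniec's `P(z, u)` (p. 314), with its API;
* `JurkatRichert.kCond_restrict_of_iwaniec` — Iwaniec's hypothesis (1) for `g` gives Nathanson's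
  `KCond (restrict g P₁) (1 + K/log w₀) z` for every sieving range `P₁` all of whose primes are
  `≥ w₀ ≥ 2` (so with constant `≤ 1 + 1/200` once `log w₀ ≥ 200 K`), where `JurkatRichert.restrict`
  is the restricted density of `JurkatRichertLinearSieveLower.lean`.

## References

* M. B. Nathanson, *Additive Number Theory: The Classical Bases*, GTM 164 (1996), Thms 9.5–9.7.
  [Nathanson1996]
* H. Iwaniec, *A new form of the error term in the linear sieve*, Acta Arith. 37 (1980), 307–320,
  Lemma 3 p. 313. [IwaniecActaArith1980b]
* H. Iwaniec, *Rosser's sieve*, Acta Arith. 36 (1980), 171–202, Lemma 18. [IwaniecActaArith1980]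
-/

open Finset Real

noncomputable section

namespace Literature.NumberTheory.Sieve

namespace JurkatRichert

open BetaSieve

variable {g : ArithmeticFunction ℝ} {K : ℝ}

/-- The error budget `12000 · 26 · m_o(s) ≤ e^{14−s}` for all `s ≥ 1` (on `[1, 3]` this is
`errorBudget`; for `s ≥ 3`, `m_o(s) = 3e^{−s}/s ≤ e^{−s}` and `312000 ≤ e^{14}`). [folklore] -/
theorem errorBudget_of_one_le {s : ℝ} (hs1 : 1 ≤ s) : 12000 * 26 * moFun s ≤ Real.exp (14 - s) := by
  rcases le_or_gt s 3 with h3 | h3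
  · exact errorBudget hs1 h3
  rw [moFun_of_three_le h3.le]
  have hs0 : 0 < s := by linarith
  have he : 0 < Real.exp (-s) := Real.exp_pos _
  have h1 : 3 * Real.exp (-s) / s ≤ Real.exp (-s) := by
    rw [div_le_iff₀ hs0]; nlinarith
  have h14 : Real.exp (14 - s) = Real.exp 14 * Real.exp (-s) := by
    rw [← Real.exp_add]; ring_nf
  rw [h14]
  nlinarith [le_exp_fourteen]

/-- **Explicit upper bound for the main term of Rosser's linear sieve, all `s ≥ 1`** (Nathanson,
Theorem 9.7 (9.35) with `R = 0`, i.e. Theorems 9.5–9.6 without the restriction `s ≤ 3` of Theorem 9.8):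
for multiplicative `g` with `0 ≤ g(p) < 1` (`p < z`), the linear-sieve condition at all levels `≤ z`
(`KCond g K z`) with `1 ≤ K ≤ 1 + 1/200`, `2 ≤ z ≤ D` and `s = log D/log z`,
`G(z, λ⁺_D) = ∑_{d ∣ P(z)} μ(d) χ⁺_D(d) g(d) ≤ V(z) (F(s) + (K − 1) e^{14−s})` with `F = upperSieveFun 1`
the upper function of the linear sieve.  (`G = V + Σ_{n odd} T_n` (`BetaSieve.mainSum_one_eq`);
Theorem 9.5 (`bdrySum_le`); `1 + Σ_{n odd ≤ N} f_n(s) ≤ F(s)` for all `s > 0` (Iwaniec's Lemma 18,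
`Iwaniec1980_lemma18.upper_of_pos`); `Σ c_n ≤ 12000 · 26`, `12000 · 26 · m_o(s) ≤ e^{14−s}`.)
[cite: Nathanson1996, Thm 9.7 (9.35)] -/
theorem mainSum_one_le_upperSieveFun (hg : g.IsMultiplicative) (hK1 : 1 ≤ K) (hK2 : K ≤ 201 / 200)
    {z D : ℝ} (hKC : KCond g K z) (h01 : ∀ p : ℕ, p.Prime → (p : ℝ) < z → 0 ≤ g p ∧ g p < 1)
    (hz : 2 ≤ z) (hzD : z ≤ D) :
    mainSum 1 g 2 D (primesProdBelow z) ≤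
      vprod g (primesProdBelow z) *
        (upperSieveFun 1 (Real.log D / Real.log z) +
          (K - 1) * Real.exp (14 - Real.log D / Real.log z)) := by
  set s := Real.log D / Real.log z with hs_def
  set P := primesProdBelow z with hP
  set V := vprod g P with hV
  set N := P.primeFactors.card with hN
  have hz1 : 1 < z := by linarith
  have hs1 : 1 ≤ s := le_log_div_log_of_rpow_le hz1 (by rwa [Real.rpow_one])
  have hs0 : 0 < s := by linarith
  have hV0 : 0 < V := vprod_pos_of_lt h01 le_rfl
  have hK0 : 0 ≤ K - 1 := by linarith
  have hmo0 : 0 < moFun s := moFun_pos s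
  rw [mainSum_one_eq hg (squarefree_primesProdBelow z) 2 D]
  set b : ℕ → ℝ := fun n =>
    if n % 2 = 1 % 2 then V * (contS 1 2 n s / s + (K - 1) * cN n * moFun s) else 0 with hb
  have hterm : ∀ n ∈ Finset.range (N + 1), bdrySum 1 g 2 D P n ≤ b n := by
    intro n _
    simp only [hb]
    by_cases hn : n % 2 = 1 % 2
    · rw [if_pos hn, bdrySum_congr_of_mod_two_eq (show 1 % 2 = n % 2 % 2 by omega)]
      have h := bdrySum_le hg hK1 hK2 n z D (by omega) hKC h01 hz (fun _ => hzD) (fun h0 => by omega)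
      rwa [major_of_odd (by omega), ← hs_def] at h
    · rw [if_neg hn, bdrySum_eq_zero_of_mod_two_ne g 2 D P hn]
  have hsumb : ∑ n ∈ Finset.range (N + 1), b n =
      V * (contT 1 1 2 N s / s) + V * ((K - 1) * moFun s) *
        ∑ n ∈ (Finset.range (N + 1)).filter (fun n => n % 2 = 1 % 2), cN n := by
    simp only [hb]
    rw [← Finset.sum_filter, contT_def, Finset.mul_sum, Finset.sum_div, Finset.mul_sum,
      ← Finset.sum_add_distrib]
    refine Finset.sum_congr rfl fun n _ => ?_
    ring
  have hgeom : ∑ n ∈ (Finset.range (N + 1)).filter (fun n => n % 2 = 1 % 2), cN n ≤ 12000 * 26 := by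
    calc ∑ n ∈ (Finset.range (N + 1)).filter (fun n => n % 2 = 1 % 2), cN n
        ≤ ∑ n ∈ Finset.range (N + 1), cN n :=
          Finset.sum_le_sum_of_subset_of_nonneg (Finset.filter_subset _ _) fun n _ _ => (cN_pos n).le
      _ = 12000 * ∑ n ∈ Finset.range (N + 1), alphaN ^ n := by rw [Finset.mul_sum]; rfl
      _ ≤ 12000 * 26 := by nlinarith [sum_alphaN_pow_le N]
  -- Lemma 18 (all `s > 0`): `s + T⁺_N(s) ≤ s F(s)`
  have hmain : s + contT 1 1 2 N s ≤ s * upperSieveFun 1 s := by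
    have h18 := Iwaniec1980_lemma18_holds.upper_of_pos (by norm_num : (1 : ℝ) / 2 ≤ 1)
      isGreatestBetaSieveData_linear N hs0
    dsimp only at h18
    rw [show siftingLimit 1 = 2 from siftingLimit_one_holds, Real.rpow_one] at h18
    linarith
  have herr := errorBudget_of_one_le hs1
  calc V + ∑ n ∈ Finset.range (N + 1), bdrySum 1 g 2 D P n
      ≤ V + ∑ n ∈ Finset.range (N + 1), b n := by
        have := Finset.sum_le_sum hterm; linarith
    _ = V + (V * (contT 1 1 2 N s / s) + V * ((K - 1) * moFun s) *
          ∑ n ∈ (Finset.range (N + 1)).filter (fun n => n % 2 = 1 % 2), cN n) := by rw [hsumb]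
    _ ≤ V + (V * (contT 1 1 2 N s / s) + V * ((K - 1) * moFun s) * (12000 * 26)) := by
        have : 0 ≤ V * ((K - 1) * moFun s) := by positivity
        nlinarith [hgeom]
    _ = V * ((s + contT 1 1 2 N s) / s + (K - 1) * (12000 * 26 * moFun s)) := by
        field_simp; ring
    _ ≤ V * (upperSieveFun 1 s + (K - 1) * Real.exp (14 - s)) := by
        refine mul_le_mul_of_nonneg_left (add_le_add ?_ ?_) hV0.le
        · rw [div_le_iff₀ hs0]; linarith
        · exact mul_le_mul_of_nonneg_left herr hK0

end JurkatRichert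

/-! ### `P(z, w) = P(z)/P(w)`, the product of the primes in `[w, z)` -/

/-- `primesProdIco w z = ∏_{w ≤ p < z} p = P(z)/P(w)` (Iwaniec's `P(z, u)`, p. 314).
[cite: IwaniecActaArith1980b, §4 p. 314] -/
def primesProdIco (w z : ℝ) : ℕ :=
  ∏ p ∈ (Nat.primesBelow ⌈z⌉₊).filter (fun p : ℕ => w ≤ (p : ℝ)), p

/-- Unfolding lemma for `primesProdIco`. [folklore] -/
theorem primesProdIco_def (w z : ℝ) :
    primesProdIco w z = ∏ p ∈ (Nat.primesBelow ⌈z⌉₊).filter (fun p : ℕ => w ≤ (p : ℝ)), p := rfl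

/-- The prime factors of `P(z, w)` are the primes `p` with `w ≤ p < z`. [folklore] -/
theorem primeFactors_primesProdIco (w z : ℝ) :
    (primesProdIco w z).primeFactors = (Nat.primesBelow ⌈z⌉₊).filter (fun p : ℕ => w ≤ (p : ℝ)) :=
  Nat.primeFactors_prod fun _ hp => Nat.prime_of_mem_primesBelow (Finset.mem_filter.mp hp).1

/-- `P(z, w) ∣ P(z)`. [folklore] -/
theorem primesProdIco_dvd_primesProdBelow (w z : ℝ) : primesProdIco w z ∣ primesProdBelow z :=
  Finset.prod_dvd_prod_of_subset _ _ _ (Finset.filter_subset _ _)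

/-- `P(z, w)` is squarefree. [folklore] -/
theorem squarefree_primesProdIco (w z : ℝ) : Squarefree (primesProdIco w z) :=
  (squarefree_primesProdBelow z).squarefree_of_dvd (primesProdIco_dvd_primesProdBelow w z)

/-- `P(z, w) ≠ 0`. [folklore] -/
theorem primesProdIco_ne_zero (w z : ℝ) : primesProdIco w z ≠ 0 :=
  (squarefree_primesProdIco w z).ne_zero

/-- A prime `p` divides `P(z, w)` iff `w ≤ p < z`. [folklore] -/
theorem dvd_primesProdIco_iff {p : ℕ} (hp : p.Prime) (w z : ℝ) :
    p ∣ primesProdIco w z ↔ w ≤ (p : ℝ) ∧ (p : ℝ) < z := by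
  have h := Nat.mem_primeFactors_of_ne_zero (primesProdIco_ne_zero w z) (p := p)
  rw [primeFactors_primesProdIco, Finset.mem_filter, Nat.mem_primesBelow, Nat.lt_ceil] at h
  constructor
  · intro hd; have h' := h.mpr ⟨hp, hd⟩; exact ⟨h'.2, h'.1.1⟩
  · rintro ⟨hw, hz⟩; exact (h.mp ⟨⟨hz, hp⟩, hw⟩).2

/-- Every prime factor of `P(z, w)` is `≥ w`. [folklore] -/
theorem le_of_mem_primeFactors_primesProdIco {w z : ℝ} {p : ℕ}
    (hp : p ∈ (primesProdIco w z).primeFactors) : w ≤ (p : ℝ) := by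
  rw [primeFactors_primesProdIco, Finset.mem_filter] at hp
  exact hp.2

/-- `P(z) = P(w) · P(z, w)` for `w ≤ z`. [folklore] -/
theorem primesProdBelow_mul_primesProdIco {w z : ℝ} (hwz : w ≤ z) :
    primesProdBelow w * primesProdIco w z = primesProdBelow z := by
  rw [primesProdBelow, primesProdBelow, primesProdIco_def,
    ← Finset.prod_filter_mul_prod_filter_not (Nat.primesBelow ⌈z⌉₊) (fun p : ℕ => (p : ℝ) < w)]
  congr 1
  · refine Finset.prod_congr ?_ fun _ _ => rfl
    ext p
    simp only [Finset.mem_filter, Nat.mem_primesBelow, Nat.lt_ceil]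
    constructor
    · rintro ⟨hpw, hp⟩; exact ⟨⟨lt_of_lt_of_le hpw hwz, hp⟩, hpw⟩
    · rintro ⟨⟨-, hp⟩, hpw⟩; exact ⟨hpw, hp⟩
  · refine Finset.prod_congr ?_ fun _ _ => rfl
    exact Finset.filter_congr fun p _ => not_lt.symm

/-- `P(w)` and `P(z, w)` are coprime (disjoint sets of primes). [folklore] -/
theorem coprime_primesProdBelow_primesProdIco (w z : ℝ) :
    Nat.Coprime (primesProdBelow w) (primesProdIco w z) := by
  rw [primesProdBelow, Nat.coprime_prod_left_iff]
  intro p hp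
  rw [primesProdIco_def, Nat.coprime_prod_right_iff]
  intro q hq
  rw [Finset.mem_filter] at hq
  rw [Nat.mem_primesBelow] at hp
  have hpw : (p : ℝ) < w := Nat.lt_ceil.mp hp.1
  have hne : p ≠ q := fun h => (not_le.mpr hpw) (h ▸ hq.2)
  exact (Nat.coprime_primes hp.2 (Nat.prime_of_mem_primesBelow hq.1)).mpr hne

/-! ### Iwaniec's condition (1) and Nathanson's `KCond` for a sieving range of primes `≥ w₀` -/

namespace JurkatRichert

open BetaSieve

variable {g : ArithmeticFunction ℝ}

/-- **Iwaniec's condition (1) gives Nathanson's condition for the density restricted to a sieving range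
of primes `≥ w₀`**: if `∏_{w ≤ p < z'} (1 − g(p))⁻¹ ≤ (log z'/log w)(1 + K/log w)` for all
`2 ≤ w < z'` (`K ≥ 0`), `0 ≤ g(p) < 1` at every prime, and `P₁ ≠ 0` has all its prime factors `≥ w₀ ≥ 2`, then
`KCond (restrict g P₁) (1 + K/log w₀) z` for every `z`:
`∏_{p ∣ P₁, u ≤ p < w} (1 − g(p))⁻¹ ≤ (1 + K/log w₀) log w/log u` for all `1 < u < w ≤ z` (the primes of
`P₁` in `[u, w)` lie in `[max(u, w₀), w)`, where (1) applies with `log max(u, w₀) ≥ log u, log w₀`).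
[cite: IwaniecActaArith1980b, (1) p. 308] -/
theorem kCond_restrict_of_iwaniec {K : ℝ} (hK : 0 ≤ K)
    (h1 : ∀ w z : ℝ, 2 ≤ w → w < z →
      ∏ p ∈ (Nat.primesBelow ⌈z⌉₊).filter (fun p : ℕ => w ≤ (p : ℝ)), (1 - g p)⁻¹ ≤
        Real.log z / Real.log w * (1 + K / Real.log w))
    (h01 : ∀ p : ℕ, p.Prime → 0 ≤ g p ∧ g p < 1)
    {w₀ : ℝ} (hw₀ : 2 ≤ w₀) {P₁ : ℕ} (hP₁ : P₁ ≠ 0)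
    (hge : ∀ p ∈ P₁.primeFactors, w₀ ≤ (p : ℝ)) (z : ℝ) :
    KCond (restrict g P₁) (1 + K / Real.log w₀) z := by
  refine kCond_restrict hP₁ fun u w hu huw _ => ?_
  have hlogu : 0 < Real.log u := Real.log_pos hu
  have hlogw : 0 < Real.log w := Real.log_pos (hu.trans huw)
  have hlogw₀ : 0 < Real.log w₀ := Real.log_pos (by linarith)
  have hratio : 1 ≤ Real.log w / Real.log u := by
    rw [le_div_iff₀ hlogu, one_mul]; exact Real.log_le_log (by linarith) huw.le
  have hK1 : 1 ≤ 1 + K / Real.log w₀ := by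
    have : 0 ≤ K / Real.log w₀ := div_nonneg hK hlogw₀.le
    linarith
  -- the primes of `P₁` in `[u, w)` form a subset of the primes in `[max u w₀, w)`; all factors are `≥ 1`
  have hsub : P₁.primeFactors.filter (fun p : ℕ => u ≤ (p : ℝ) ∧ (p : ℝ) < w) ⊆
      (Nat.primesBelow ⌈w⌉₊).filter (fun p : ℕ => max u w₀ ≤ (p : ℝ)) := by
    intro p hp
    rw [Finset.mem_filter] at hp
    rw [Finset.mem_filter, Nat.mem_primesBelow, Nat.lt_ceil]
    exact ⟨⟨hp.2.2, Nat.prime_of_mem_primeFactors hp.1⟩, max_le hp.2.1 (hge p hp.1)⟩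
  have hle : ∏ p ∈ P₁.primeFactors.filter (fun p : ℕ => u ≤ (p : ℝ) ∧ (p : ℝ) < w), (1 - g p)⁻¹ ≤
      ∏ p ∈ (Nat.primesBelow ⌈w⌉₊).filter (fun p : ℕ => max u w₀ ≤ (p : ℝ)), (1 - g p)⁻¹ := by
    refine Finset.prod_le_prod_of_subset_of_one_le hsub (fun p hp => ?_) (fun p hp _ => ?_)
    · rw [Finset.mem_filter] at hp
      have h := h01 p (Nat.prime_of_mem_primeFactors hp.1)
      exact inv_nonneg.mpr (by linarith [h.2])
    · rw [Finset.mem_filter, Nat.mem_primesBelow] at hp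
      have h := h01 p hp.1.2
      exact (one_le_inv₀ (by linarith [h.2])).mpr (by linarith [h.1])
  refine hle.trans ?_
  rcases lt_or_ge (max u w₀) w with hlt | hge'
  · -- apply (1) with `w' = max u w₀ ≥ 2`
    have h2 : 2 ≤ max u w₀ := le_trans hw₀ (le_max_right _ _)
    have hlogm : 0 < Real.log (max u w₀) := Real.log_pos (by linarith)
    have hmu : Real.log u ≤ Real.log (max u w₀) := Real.log_le_log (by linarith) (le_max_left _ _)
    have hmw₀ : Real.log w₀ ≤ Real.log (max u w₀) := Real.log_le_log (by linarith) (le_max_right _ _)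
    refine (h1 (max u w₀) w h2 hlt).trans ?_
    have hA : Real.log w / Real.log (max u w₀) ≤ Real.log w / Real.log u :=
      div_le_div_of_nonneg_left hlogw.le hlogu hmu
    have hB : 1 + K / Real.log (max u w₀) ≤ 1 + K / Real.log w₀ := by
      have := div_le_div_of_nonneg_left hK hlogw₀ hmw₀
      linarith
    calc Real.log w / Real.log (max u w₀) * (1 + K / Real.log (max u w₀))
        ≤ Real.log w / Real.log u * (1 + K / Real.log w₀) :=
          mul_le_mul hA hB (by linarith [div_nonneg hK hlogm.le]) (div_nonneg hlogw.le hlogu.le)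
      _ = (1 + K / Real.log w₀) * (Real.log w / Real.log u) := mul_comm _ _
  · -- the range is empty
    have hempty : (Nat.primesBelow ⌈w⌉₊).filter (fun p : ℕ => max u w₀ ≤ (p : ℝ)) = ∅ := by
      refine Finset.filter_false_of_mem fun p hp => ?_
      rw [Nat.mem_primesBelow] at hp
      have : (p : ℝ) < w := Nat.lt_ceil.mp hp.1
      exact not_le.mpr (this.trans_le hge')
    rw [hempty, Finset.prod_empty]
    nlinarith

end JurkatRichert

end Literature.NumberTheory.Sieve

end
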